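import Literature.MathematicalPhysics.QuantumManyBody.BogoliubovTrialEnergyWeighted
import Literature.MathematicalPhysics.QuantumManyBody.DiluteBoseGasTrialLambda
import HarnessLib

/-!
# The BCS trial state: the energy functional reduced to scalars

Topic `Literature/MathematicalPhysics/QuantumManyBody`, namespace `BoseGas.BCSTrial`; theorem-only, for
the provefact `Literature.MathematicalPhysics.QuantumManyBody.BoseGas.BastiCenatiempoSchlein2021_upperBound`.

`trialEnergy_le`: for the concrete trial state of `DiluteBoseGasTrialState.lean` (`Ψ = W(N₀)T_νξ_ν/‖ξ_ν‖`
with the Galerkin `η`, `N₀ = N - S`), the sector-averaged periodic ground-state energies are bounded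
by the scalar main terms and explicit scalar errors of `trialNumerator_cubicVector_le''`
(Props. 3.1–3.2 of [BastiCenatiempoSchlein2021]), per unit `‖ξ_ν‖²`:
`∑_n c_n E^per(n,L) ≤ KIN + (MAIN + ERR)/(2L³)`, with the sup parameters instantiated from
`DiluteBoseGasTrialSums.lean` (`g₀, s₀, gs₀`), `DiluteBoseGasTrialLambda.lean` (`Λ`) and the four
coincidence quantities defined as the suprema / weighted sums themselves (`F₁, F₂, F₁^V, F₂^V`;
their bounds are separate).

## References

* [BastiCenatiempoSchlein2021] G. Basti, S. Cenatiempo, B. Schlein, Forum Math. Sigma 9 (2021) e74,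
  arXiv:2101.06222: Prop. 1.3, (2.14), Prop. 2.4, Props. 3.1–3.2.
-/

noncomputable section

namespace Literature.MathematicalPhysics.QuantumManyBody.BoseGas

open MeasureTheory Complex Finset MvPolynomial
open scoped ENNReal NNReal BigOperators ComplexConjugate

namespace BCSTrial

variable {v : ℝ → ℝ≥0∞} {ρ : ℝ}

/-! ### The cubic vector is not zero -/

/-- `1 ≤ ‖ξ_ν‖²` (the empty set of triples contributes `1`). [folklore] -/
theorem one_le_cubicNormSq (v : ℝ → ℝ≥0∞) (ρ : ℝ) : 1 ≤ Fock.cubicNormSq (kappa v ρ) := by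
  classical
  unfold Fock.cubicNormSq
  have h1 : ‖Fock.setCoeff (kappa v ρ) (Fock.TripleAdm (e (boxSize ρ))) (∅ : Finset (Fock.Triple (e (boxSize ρ)) (hardSet ρ) (softSet ρ)))‖ ^ 2 = 1 := by
    unfold Fock.setCoeff
    have hadm : Fock.TripleAdm (e (boxSize ρ)) (∅ : Finset (Fock.Triple (e (boxSize ρ)) (hardSet ρ) (softSet ρ))) := by
      intro τi hi; simp at hi
    rw [if_pos hadm]
    simp
  rw [← h1]
  exact Finset.single_le_sum (f := fun S : Finset (Fock.Triple (e (boxSize ρ)) (hardSet ρ) (softSet ρ)) =>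
    ‖Fock.setCoeff (kappa v ρ) (Fock.TripleAdm (e (boxSize ρ))) S‖ ^ 2) (fun _ _ => sq_nonneg _) (Finset.mem_univ _)

/-- `ξ_ν ≠ 0`. [folklore] -/
theorem xi_ne_zero (v : ℝ → ℝ≥0∞) {ρ : ℝ} (hρ : 0 < ρ) (hρ1 : ρ ≤ 1) : xi v ρ ≠ 0 := by
  intro h
  have h1 := Fock.cubicNormSq_eq (disjoint_hardSet_softSet hρ hρ1) (kappa v ρ)
  have h2 := one_le_cubicNormSq v ρ
  unfold xi at h
  rw [h, Fock.fockInner_zero_left, Complex.zero_re] at h1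
  linarith

/-! ### The sup parameters on `P_H ∪ P_S` -/

/-- **`|σ| ≤ s₀, |γ| ≤ g₀, |γσ| ≤ g₀s₀` on `P_H ∪ P_S`** with `s₀² = A`, `g₀² = 1 + A`,
`A = (√W(0)/(4√2π))ρ^{-1/20} + (W(0)²/(48π⁴))ρ^{8/5}`. [cite: BastiCenatiempoSchlein2021, §2 (bounds after (2.11))] -/
theorem angle_sups (hv : Measurable v) (hint : (∫⁻ x : Space, v ‖x‖) ≠ ⊤) (hρ : 0 < ρ) (hρ1 : ρ ≤ 1)
    {p : ModeBox (boxSize ρ)} (hp : p ∈ hardSet ρ ∪ softSet ρ) :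
    |Fock.bogSigma (neg _) (halfSpace _) (tAmp v ρ) p| ≤
        Real.sqrt (Real.sqrt (W v ρ 0) / (4 * Real.sqrt 2 * Real.pi) * ρ ^ (-(1 : ℝ) / 20) +
          W v ρ 0 ^ 2 / (48 * Real.pi ^ 4) * ρ ^ ((8 : ℝ) / 5)) ∧
      |Fock.bogGamma (neg _) (halfSpace _) (tAmp v ρ) p| ≤
        Real.sqrt (1 + (Real.sqrt (W v ρ 0) / (4 * Real.sqrt 2 * Real.pi) * ρ ^ (-(1 : ℝ) / 20) +
          W v ρ 0 ^ 2 / (48 * Real.pi ^ 4) * ρ ^ ((8 : ℝ) / 5))) ∧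
      |Fock.bogGamma (neg _) (halfSpace _) (tAmp v ρ) p * Fock.bogSigma (neg _) (halfSpace _) (tAmp v ρ) p| ≤
        Real.sqrt (1 + (Real.sqrt (W v ρ 0) / (4 * Real.sqrt 2 * Real.pi) * ρ ^ (-(1 : ℝ) / 20) +
          W v ρ 0 ^ 2 / (48 * Real.pi ^ 4) * ρ ^ ((8 : ℝ) / 5))) *
        Real.sqrt (Real.sqrt (W v ρ 0) / (4 * Real.sqrt 2 * Real.pi) * ρ ^ (-(1 : ℝ) / 20) +
          W v ρ 0 ^ 2 / (48 * Real.pi ^ 4) * ρ ^ ((8 : ℝ) / 5)) := by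
  set A := Real.sqrt (W v ρ 0) / (4 * Real.sqrt 2 * Real.pi) * ρ ^ (-(1 : ℝ) / 20) +
    W v ρ 0 ^ 2 / (48 * Real.pi ^ 4) * ρ ^ ((8 : ℝ) / 5) with hA
  have hW0 := W_zero_nonneg v ρ
  have hA1 : 0 ≤ Real.sqrt (W v ρ 0) / (4 * Real.sqrt 2 * Real.pi) * ρ ^ (-(1 : ℝ) / 20) := by positivity
  have hA2 : 0 ≤ W v ρ 0 ^ 2 / (48 * Real.pi ^ 4) * ρ ^ ((8 : ℝ) / 5) := by positivity
  have hσ2 : Fock.bogSigma (neg _) (halfSpace _) (tAmp v ρ) p ^ 2 ≤ A := by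
    rcases Finset.mem_union.1 hp with h | h
    · exact (sigma_sq_le_of_mem_hardSet hv hint hρ hρ1 h).trans (by linarith)
    · exact (sigma_sq_le_of_mem_softSet hv hint hρ h).trans (by linarith)
  have hs : |Fock.bogSigma (neg _) (halfSpace _) (tAmp v ρ) p| ≤ Real.sqrt A :=
    Real.abs_le_sqrt hσ2
  have hg : |Fock.bogGamma (neg _) (halfSpace _) (tAmp v ρ) p| ≤ Real.sqrt (1 + A) := by
    refine Real.abs_le_sqrt ?_
    rw [gamma_sq_eq hv hint hρ]; linarith
  refine ⟨hs, hg, ?_⟩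
  rw [abs_mul]
  exact mul_le_mul hg hs (abs_nonneg _) (Real.sqrt_nonneg _)

/-! ### The energy functional, reduced -/

set_option maxHeartbeats 2000000 in
/-- **The energy of the trial state reduced to scalars** (`∑_n c_nE^per(n,L) ≤ KIN + (MAIN + ERR)/(2L³)`
per unit `‖ξ_ν‖²`; hypotheses: `L > 2R₀`, `N₀ ≥ 0`). [cite: BastiCenatiempoSchlein2021, Prop. 1.3 (proof), (2.14), Props. 3.1–3.2] -/
theorem trialEnergy_le (hv : Measurable v) (hint : (∫⁻ x : Space, v ‖x‖) ≠ ⊤) {R₀ : ℝ} (hsupp : ∀ r, R₀ < r → v r = 0)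
    (h2 : (∫⁻ z : Space, v ‖z‖ ^ 2) ≠ ⊤) (hρ : 0 < ρ) (hρ1 : ρ ≤ 1) (hR : 2 * R₀ < boxSide ρ)
    (hN₀ : 0 ≤ condensate v ρ) :
    let GM := Fock.bogGamma (neg (boxSize ρ)) (halfSpace (boxSize ρ)) (tAmp v ρ)
    let SG := Fock.bogSigma (neg (boxSize ρ)) (halfSpace (boxSize ρ)) (tAmp v ρ)
    let Wc : Momentum → ℂ := fun k => ((W v ρ k : ℝ) : ℂ)
    let A : ℝ := Real.sqrt (W v ρ 0) / (4 * Real.sqrt 2 * Real.pi) * ρ ^ (-(1 : ℝ) / 20) +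
      W v ρ 0 ^ 2 / (48 * Real.pi ^ 4) * ρ ^ ((8 : ℝ) / 5)
    let g₀ : ℝ := Real.sqrt (1 + A)
    let s₀ : ℝ := Real.sqrt A
    let gs₀ : ℝ := Real.sqrt (1 + A) * Real.sqrt A
    let Λ : ℝ := W v ρ 0 * (24 / (Real.sqrt 2 * Real.pi) * Real.sqrt (W v ρ 0) * ρ ^ (-(9 : ℝ) / 5) +
          12 / Real.pi ^ 2 * W v ρ 0 * ρ ^ (-(19 : ℝ) / 10)) +
        ρ * W v ρ 0 * boxSide ρ ^ 2 / (6 * Real.pi ^ 2) *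
          (96 * W v ρ 0 * ρ ^ (-(11 : ℝ) / 10) +
            Real.sqrt (192 * Real.sqrt 3) * Real.sqrt (∫ z : Space, (v ‖z‖).toReal ^ 2) * boxSide ρ)
    let F₁ : ℝ := (((Finset.univ.sup fun τ' : Fock.Triple (e (boxSize ρ)) (hardSet ρ) (softSet ρ) => Real.toNNReal (∑ τ : Fock.Triple (e (boxSize ρ)) (hardSet ρ) (softSet ρ),
      (if τ.b = τ'.b ∨ (∃ p, (p = τ.u ∨ p = τ.a) ∧ (p = τ'.u ∨ p = τ'.a)) ∨
          (∃ p, (p = τ.u ∨ p = τ.a) ∧ e (boxSize ρ) p + e (boxSize ρ) p + e (boxSize ρ) τ'.b = 0) ∨ (∃ p', (p' = τ'.u ∨ p' = τ'.a) ∧ e (boxSize ρ) p' + e (boxSize ρ) p' + e (boxSize ρ) τ.b = 0)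
        then ‖Fock.arrSum (Fock.cubicCoeff (e (boxSize ρ)) Wc GM SG) τ‖ * ‖kappa v ρ τ‖ else 0))) : ℝ≥0) : ℝ)
    let F₂ : ℝ := ∑ τj : Fock.Triple (e (boxSize ρ)) (hardSet ρ) (softSet ρ), ∑ τk : Fock.Triple (e (boxSize ρ)) (hardSet ρ) (softSet ρ), ‖kappa v ρ τj‖ ^ 2 * ‖kappa v ρ τk‖ ^ 2 * ∑ τ : Fock.Triple (e (boxSize ρ)) (hardSet ρ) (softSet ρ),
      (if (∃ pj pk, (pj = τj.u ∨ pj = τj.a) ∧ (pk = τk.u ∨ pk = τk.a) ∧ e (boxSize ρ) pj + e (boxSize ρ) pk + e (boxSize ρ) τ.b = 0) ∨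
          (∃ p pk, (p = τ.u ∨ p = τ.a) ∧ (pk = τk.u ∨ pk = τk.a) ∧ e (boxSize ρ) p + e (boxSize ρ) pk + e (boxSize ρ) τj.b = 0)
        then ‖Fock.arrSum (Fock.cubicCoeff (e (boxSize ρ)) Wc GM SG) τ‖ * ‖kappa v ρ τ‖ else 0)
    let F₁V : ℝ := (((Finset.univ.sup fun τ' : Fock.Triple (e (boxSize ρ)) (hardSet ρ) (softSet ρ) => Real.toNNReal (∑ τ : Fock.Triple (e (boxSize ρ)) (hardSet ρ) (softSet ρ),
      (if τ.b = τ'.b ∨ (∃ p, (p = τ.u ∨ p = τ.a) ∧ (p = τ'.u ∨ p = τ'.a)) ∨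
          (∃ p, (p = τ.u ∨ p = τ.a) ∧ e (boxSize ρ) p + e (boxSize ρ) p + e (boxSize ρ) τ'.b = 0) ∨ (∃ p', (p' = τ'.u ∨ p' = τ'.a) ∧ e (boxSize ρ) p' + e (boxSize ρ) p' + e (boxSize ρ) τ.b = 0)
        then (‖kappa v ρ τ‖ * ((∑ τ₂ : Fock.Triple (e (boxSize ρ)) (hardSet ρ) (softSet ρ), (if τ₂.b = τ.b then ‖kappa v ρ τ₂‖ * ‖(Fock.hardKernel (e (boxSize ρ)) Wc GM (hardSet ρ) τ₂.u τ₂.a τ.u τ.a +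
            Fock.hardKernel (e (boxSize ρ)) Wc GM (hardSet ρ) τ₂.u τ₂.a τ.a τ.u + Fock.hardKernel (e (boxSize ρ)) Wc GM (hardSet ρ) τ₂.a τ₂.u τ.u τ.a +
            Fock.hardKernel (e (boxSize ρ)) Wc GM (hardSet ρ) τ₂.a τ₂.u τ.a τ.u)‖ else 0)) +
          ∑ τ₁ : Fock.Triple (e (boxSize ρ)) (hardSet ρ) (softSet ρ), (if τ.b = τ₁.b then ‖kappa v ρ τ₁‖ * ‖(Fock.hardKernel (e (boxSize ρ)) Wc GM (hardSet ρ) τ.u τ.a τ₁.u τ₁.a +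
            Fock.hardKernel (e (boxSize ρ)) Wc GM (hardSet ρ) τ.u τ.a τ₁.a τ₁.u + Fock.hardKernel (e (boxSize ρ)) Wc GM (hardSet ρ) τ.a τ.u τ₁.u τ₁.a +
            Fock.hardKernel (e (boxSize ρ)) Wc GM (hardSet ρ) τ.a τ.u τ₁.a τ₁.u)‖ else 0))) else 0))) : ℝ≥0) : ℝ)
    let F₂V : ℝ := ∑ τj : Fock.Triple (e (boxSize ρ)) (hardSet ρ) (softSet ρ), ∑ τk : Fock.Triple (e (boxSize ρ)) (hardSet ρ) (softSet ρ), ‖kappa v ρ τj‖ ^ 2 * ‖kappa v ρ τk‖ ^ 2 * ∑ τ : Fock.Triple (e (boxSize ρ)) (hardSet ρ) (softSet ρ),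
      (if (∃ pj pk, (pj = τj.u ∨ pj = τj.a) ∧ (pk = τk.u ∨ pk = τk.a) ∧ e (boxSize ρ) pj + e (boxSize ρ) pk + e (boxSize ρ) τ.b = 0) ∨
          (∃ p pk, (p = τ.u ∨ p = τ.a) ∧ (pk = τk.u ∨ pk = τk.a) ∧ e (boxSize ρ) p + e (boxSize ρ) pk + e (boxSize ρ) τj.b = 0)
        then (‖kappa v ρ τ‖ * ((∑ τ₂ : Fock.Triple (e (boxSize ρ)) (hardSet ρ) (softSet ρ), (if τ₂.b = τ.b then ‖kappa v ρ τ₂‖ * ‖(Fock.hardKernel (e (boxSize ρ)) Wc GM (hardSet ρ) τ₂.u τ₂.a τ.u τ.a +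
            Fock.hardKernel (e (boxSize ρ)) Wc GM (hardSet ρ) τ₂.u τ₂.a τ.a τ.u + Fock.hardKernel (e (boxSize ρ)) Wc GM (hardSet ρ) τ₂.a τ₂.u τ.u τ.a +
            Fock.hardKernel (e (boxSize ρ)) Wc GM (hardSet ρ) τ₂.a τ₂.u τ.a τ.u)‖ else 0)) +
          ∑ τ₁ : Fock.Triple (e (boxSize ρ)) (hardSet ρ) (softSet ρ), (if τ.b = τ₁.b then ‖kappa v ρ τ₁‖ * ‖(Fock.hardKernel (e (boxSize ρ)) Wc GM (hardSet ρ) τ.u τ.a τ₁.u τ₁.a +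
            Fock.hardKernel (e (boxSize ρ)) Wc GM (hardSet ρ) τ.u τ.a τ₁.a τ₁.u + Fock.hardKernel (e (boxSize ρ)) Wc GM (hardSet ρ) τ.a τ.u τ₁.u τ₁.a +
            Fock.hardKernel (e (boxSize ρ)) Wc GM (hardSet ρ) τ.a τ.u τ₁.a τ₁.u)‖ else 0))) else 0)
    ∑' n, weight v ρ n * periodicGroundStateEnergy v n (boxSide ρ) ≤ ENNReal.ofReal (

      -- kinetic: constant + `⟨𝒦⟩ + E₁`
      ((∑ p, eps ρ p * SG p ^ 2) +
        ∑ τ : Fock.Triple (e (boxSize ρ)) (hardSet ρ) (softSet ρ), (eps ρ τ.u * (GM τ.u ^ 2 + SG τ.u ^ 2) +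
          eps ρ τ.a * (GM τ.a ^ 2 + SG τ.a ^ 2) +
          eps ρ τ.b * (GM τ.b ^ 2 + SG τ.b ^ 2)) * ‖kappa v ρ τ‖ ^ 2) +
      ( -- main terms of the quartic form: hard block, cubic block, constants
        (∑ τ' : Fock.Triple (e (boxSize ρ)) (hardSet ρ) (softSet ρ), ∑ τ : Fock.Triple (e (boxSize ρ)) (hardSet ρ) (softSet ρ), (if τ.b = τ'.b then
          kappa v ρ τ' * conj (kappa v ρ τ) * (Fock.hardKernel (e (boxSize ρ)) Wc GM (hardSet ρ) τ.u τ.a τ'.u τ'.a +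
            Fock.hardKernel (e (boxSize ρ)) Wc GM (hardSet ρ) τ.u τ.a τ'.a τ'.u + Fock.hardKernel (e (boxSize ρ)) Wc GM (hardSet ρ) τ.a τ.u τ'.u τ'.a +
            Fock.hardKernel (e (boxSize ρ)) Wc GM (hardSet ρ) τ.a τ.u τ'.a τ'.u) else 0)).re +
        Real.sqrt (condensate v ρ) * ((∑ τ : Fock.Triple (e (boxSize ρ)) (hardSet ρ) (softSet ρ), Fock.arrSum (Fock.cubicCoeff (e (boxSize ρ)) Wc GM SG) τ * conj (kappa v ρ τ)).re) +
        (((condensate v ρ : ℝ) : ℂ) ^ 2 * Wc 0 +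
          ((condensate v ρ : ℝ) : ℂ) * (∑ p, ((2 * Wc 0 + Wc (e (boxSize ρ) p) + Wc (-e (boxSize ρ) p)) * ((SG p ^ 2 : ℝ) : ℂ) +
            (Wc (e (boxSize ρ) p) + Wc (-e (boxSize ρ) p)) * ((GM p * SG p : ℝ) : ℂ))) +
          (∑ p, ∑ p', Wc (e (boxSize ρ) p' - e (boxSize ρ) p) *
            (((GM p * SG p * (GM p' * SG p')) : ℝ) : ℂ)) +
          ((∑ p, ∑ q, Wc (e (boxSize ρ) q - e (boxSize ρ) p) * (((SG p ^ 2 * SG q ^ 2 : ℝ)) : ℂ)) +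
            Wc 0 * ((((∑ p, SG p ^ 2) ^ 2 : ℝ)) : ℂ))).re +
        -- errors
        (((F₁V * Fock.ampNormSq (kappa v ρ) + F₂V) +
            16 * (W v ρ 0 * g₀ ^ 4) * (Fock.ampNormSq (kappa v ρ) ^ 2 + Fock.ampNormSq (kappa v ρ))) +
          Real.sqrt (condensate v ρ) * (F₁ * Fock.ampNormSq (kappa v ρ) + F₂) +
          ((condensate v ρ * (4 * W v ρ 0 * (g₀ ^ 2 + s₀ ^ 2 + gs₀)) + 4 * gs₀ * Λ + 4 * W v ρ 0 * (∑ p, SG p ^ 2) * g₀ ^ 2 +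
              4 * W v ρ 0 * (∑ p, SG p ^ 2) * s₀ ^ 2) * (3 * Fock.ampNormSq (kappa v ρ)) +
            (4 * W v ρ 0 * g₀ ^ 2 * (∑ p, SG p ^ 2) + W v ρ 0 * s₀ ^ 2 * (∑ p ∈ hardSet ρ ∪ softSet ρ, SG p ^ 2) +
              2 * W v ρ 0 * g₀ ^ 4 * ((softSet ρ).card : ℝ)) * (9 * (Fock.ampNormSq (kappa v ρ) ^ 2 + Fock.ampNormSq (kappa v ρ)))))) / (2 * boxSide ρ ^ 3)) := by
  intro GM SG Wc A g₀ s₀ gs₀ Λ F₁ F₂ F₁V F₂V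
  classical
  have hL := boxSide_pos hρ
  have hW0 := W_zero_nonneg v ρ
  have hHS := disjoint_hardSet_softSet hρ hρ1
  have ht := abs_tAmp_lt_one' hv hint hρ
  have hξ := xi_ne_zero v hρ hρ1
  -- (1) the energy functional
  have hE := tsum_trialWeight_mul_periodicGroundStateEnergy_le (z := z (boxSize ρ)) (σ := neg _) (P := halfSpace _)
    (N₀ := condensate v ρ) (t := tAmp v ρ) (e := e (boxSize ρ)) (L := boxSide ρ)
    (neg_involutive _) (neg_z _) (fun q hq => neg_not_mem_halfSpace hq) hN₀ ht hξ hL hv hint (e_injective _)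
  -- (2) the sup parameters
  have hAS : ∀ p ∈ hardSet ρ ∪ softSet ρ, |GM p| ≤ g₀ ∧ |SG p| ≤ s₀ ∧ |GM p * SG p| ≤ gs₀ := fun p hp => by
    obtain ⟨h1, h2, h3⟩ := angle_sups hv hint hρ hρ1 hp
    exact ⟨h2, h1, h3⟩
  have hW : ∀ k, ‖Wc k‖ ≤ W v ρ 0 := fun k => by
    show ‖((W v ρ k : ℝ) : ℂ)‖ ≤ W v ρ 0
    rw [Complex.norm_real, Real.norm_eq_abs]; exact abs_W_le v ρ k
  have hWev : ∀ k, Wc (-k) = Wc k := fun k => by show ((W v ρ (-k) : ℝ) : ℂ) = ((W v ρ k : ℝ) : ℂ); rw [W_neg]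
  have hΛ : ∀ k, ∑ p, ‖Wc (k - e _ p)‖ * |GM p * SG p| ≤ Λ := fun k => by
    have h := Lambda_le hv hint hρ hsupp hR h2 k
    refine le_trans (le_of_eq (Finset.sum_congr rfl fun p _ => ?_)) h
    show ‖((W v ρ (k - e _ p) : ℝ) : ℂ)‖ * _ = _
    rw [Complex.norm_real, Real.norm_eq_abs]
  -- (3) the coincidence quantities
  have hF₁le : ∀ τ' : Fock.Triple (e (boxSize ρ)) (hardSet ρ) (softSet ρ), ∑ τ : Fock.Triple (e (boxSize ρ)) (hardSet ρ) (softSet ρ),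
      (if τ.b = τ'.b ∨ (∃ p, (p = τ.u ∨ p = τ.a) ∧ (p = τ'.u ∨ p = τ'.a)) ∨
          (∃ p, (p = τ.u ∨ p = τ.a) ∧ e (boxSize ρ) p + e (boxSize ρ) p + e (boxSize ρ) τ'.b = 0) ∨ (∃ p', (p' = τ'.u ∨ p' = τ'.a) ∧ e (boxSize ρ) p' + e (boxSize ρ) p' + e (boxSize ρ) τ.b = 0)
        then ‖Fock.arrSum (Fock.cubicCoeff (e (boxSize ρ)) Wc GM SG) τ‖ * ‖kappa v ρ τ‖ else 0) ≤ F₁ := fun τ' => by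
    refine (Real.le_coe_toNNReal _).trans ?_
    exact NNReal.coe_le_coe.2 (Finset.le_sup (f := fun τ' : Fock.Triple (e (boxSize ρ)) (hardSet ρ) (softSet ρ) => Real.toNNReal (∑ τ : Fock.Triple (e (boxSize ρ)) (hardSet ρ) (softSet ρ),
      (if τ.b = τ'.b ∨ (∃ p, (p = τ.u ∨ p = τ.a) ∧ (p = τ'.u ∨ p = τ'.a)) ∨
          (∃ p, (p = τ.u ∨ p = τ.a) ∧ e (boxSize ρ) p + e (boxSize ρ) p + e (boxSize ρ) τ'.b = 0) ∨ (∃ p', (p' = τ'.u ∨ p' = τ'.a) ∧ e (boxSize ρ) p' + e (boxSize ρ) p' + e (boxSize ρ) τ.b = 0)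
        then ‖Fock.arrSum (Fock.cubicCoeff (e (boxSize ρ)) Wc GM SG) τ‖ * ‖kappa v ρ τ‖ else 0))) (Finset.mem_univ τ'))
  have hF₁Vle : ∀ τ' : Fock.Triple (e (boxSize ρ)) (hardSet ρ) (softSet ρ), ∑ τ : Fock.Triple (e (boxSize ρ)) (hardSet ρ) (softSet ρ),
      (if τ.b = τ'.b ∨ (∃ p, (p = τ.u ∨ p = τ.a) ∧ (p = τ'.u ∨ p = τ'.a)) ∨
          (∃ p, (p = τ.u ∨ p = τ.a) ∧ e (boxSize ρ) p + e (boxSize ρ) p + e (boxSize ρ) τ'.b = 0) ∨ (∃ p', (p' = τ'.u ∨ p' = τ'.a) ∧ e (boxSize ρ) p' + e (boxSize ρ) p' + e (boxSize ρ) τ.b = 0)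
        then (‖kappa v ρ τ‖ * ((∑ τ₂ : Fock.Triple (e (boxSize ρ)) (hardSet ρ) (softSet ρ), (if τ₂.b = τ.b then ‖kappa v ρ τ₂‖ * ‖(Fock.hardKernel (e (boxSize ρ)) Wc GM (hardSet ρ) τ₂.u τ₂.a τ.u τ.a +
            Fock.hardKernel (e (boxSize ρ)) Wc GM (hardSet ρ) τ₂.u τ₂.a τ.a τ.u + Fock.hardKernel (e (boxSize ρ)) Wc GM (hardSet ρ) τ₂.a τ₂.u τ.u τ.a +
            Fock.hardKernel (e (boxSize ρ)) Wc GM (hardSet ρ) τ₂.a τ₂.u τ.a τ.u)‖ else 0)) +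
          ∑ τ₁ : Fock.Triple (e (boxSize ρ)) (hardSet ρ) (softSet ρ), (if τ.b = τ₁.b then ‖kappa v ρ τ₁‖ * ‖(Fock.hardKernel (e (boxSize ρ)) Wc GM (hardSet ρ) τ.u τ.a τ₁.u τ₁.a +
            Fock.hardKernel (e (boxSize ρ)) Wc GM (hardSet ρ) τ.u τ.a τ₁.a τ₁.u + Fock.hardKernel (e (boxSize ρ)) Wc GM (hardSet ρ) τ.a τ.u τ₁.u τ₁.a +
            Fock.hardKernel (e (boxSize ρ)) Wc GM (hardSet ρ) τ.a τ.u τ₁.a τ₁.u)‖ else 0))) else 0) ≤ F₁V := fun τ' => by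
    refine (Real.le_coe_toNNReal _).trans ?_
    exact NNReal.coe_le_coe.2 (Finset.le_sup (f := fun τ' : Fock.Triple (e (boxSize ρ)) (hardSet ρ) (softSet ρ) => Real.toNNReal (∑ τ : Fock.Triple (e (boxSize ρ)) (hardSet ρ) (softSet ρ),
      (if τ.b = τ'.b ∨ (∃ p, (p = τ.u ∨ p = τ.a) ∧ (p = τ'.u ∨ p = τ'.a)) ∨
          (∃ p, (p = τ.u ∨ p = τ.a) ∧ e (boxSize ρ) p + e (boxSize ρ) p + e (boxSize ρ) τ'.b = 0) ∨ (∃ p', (p' = τ'.u ∨ p' = τ'.a) ∧ e (boxSize ρ) p' + e (boxSize ρ) p' + e (boxSize ρ) τ.b = 0)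
        then (‖kappa v ρ τ‖ * ((∑ τ₂ : Fock.Triple (e (boxSize ρ)) (hardSet ρ) (softSet ρ), (if τ₂.b = τ.b then ‖kappa v ρ τ₂‖ * ‖(Fock.hardKernel (e (boxSize ρ)) Wc GM (hardSet ρ) τ₂.u τ₂.a τ.u τ.a +
            Fock.hardKernel (e (boxSize ρ)) Wc GM (hardSet ρ) τ₂.u τ₂.a τ.a τ.u + Fock.hardKernel (e (boxSize ρ)) Wc GM (hardSet ρ) τ₂.a τ₂.u τ.u τ.a +
            Fock.hardKernel (e (boxSize ρ)) Wc GM (hardSet ρ) τ₂.a τ₂.u τ.a τ.u)‖ else 0)) +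
          ∑ τ₁ : Fock.Triple (e (boxSize ρ)) (hardSet ρ) (softSet ρ), (if τ.b = τ₁.b then ‖kappa v ρ τ₁‖ * ‖(Fock.hardKernel (e (boxSize ρ)) Wc GM (hardSet ρ) τ.u τ.a τ₁.u τ₁.a +
            Fock.hardKernel (e (boxSize ρ)) Wc GM (hardSet ρ) τ.u τ.a τ₁.a τ₁.u + Fock.hardKernel (e (boxSize ρ)) Wc GM (hardSet ρ) τ.a τ.u τ₁.u τ₁.a +
            Fock.hardKernel (e (boxSize ρ)) Wc GM (hardSet ρ) τ.a τ.u τ₁.a τ₁.u)‖ else 0))) else 0))) (Finset.mem_univ τ'))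
  have hF₁ : 0 ≤ F₁ := NNReal.coe_nonneg _
  have hF₁V : 0 ≤ F₁V := NNReal.coe_nonneg _
  -- (4) the reduction
  have hT := Fock.trialNumerator_cubicVector_le'' (z := z (boxSize ρ)) (σ := neg _) (P := halfSpace _)
    (N₀ := condensate v ρ) (t := tAmp v ρ) (e := e (boxSize ρ)) (PH := hardSet ρ) (PS := softSet ρ)
    (neg_involutive _) (fun q hq => neg_not_mem_halfSpace hq) (neg_z _) (e_injective _) (e_z _) (e_neg _) hN₀
    Wc hW hWev hHS (z_not_mem_hardSet hρ) (z_not_mem_softSet hρ)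
    (fun p hp => by
      rcases Finset.mem_union.1 hp with h | h
      · exact Finset.mem_union_left _ (neg_mem_hardSet_iff.2 h)
      · exact Finset.mem_union_right _ (neg_mem_softSet_iff.2 h))
    (g₀ := g₀) (s₀ := s₀) (gs₀ := gs₀) (Λ := Λ) (Real.sqrt_nonneg _) (Real.sqrt_nonneg _) (by positivity)
    (fun p hp => (hAS p hp).1) (fun p hp => (hAS p hp).2.1) (fun p hp => (hAS p hp).2.2) hΛ
    (kappa v ρ) (eps ρ) eps_nonneg eps_neg eps_z hL (F₁ := F₁) (F₂ := F₂) (F₁V := F₁V) (F₂V := F₂V) hF₁ hF₁V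
    hF₁le le_rfl hF₁Vle le_rfl
  -- (5) identify the functional with the left side of the reduction
  have hNrm : (Fock.fockInner (xi v ρ) (xi v ρ)).re = Fock.cubicNormSq (kappa v ρ) := Fock.cubicNormSq_eq hHS (kappa v ρ)
  have hNrm1 := one_le_cubicNormSq v ρ
  have hLHS : (∑ p, ‖waveVector (boxSide ρ) (e _ p)‖ ^ 2 *
          (Fock.fockInner (Fock.conjAn (z _) (neg _) (halfSpace _) (condensate v ρ) (tAmp v ρ) p (xi v ρ))
            (Fock.conjAn (z _) (neg _) (halfSpace _) (condensate v ρ) (tAmp v ρ) p (xi v ρ))).re +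
        (∑ p, ∑ q, ∑ p', ∑ q', if e _ p + e _ q = e _ p' + e _ q' then
          potFT v (boxSide ρ) (e _ p' - e _ p) *
            Fock.fockInner (Fock.conjAn (z _) (neg _) (halfSpace _) (condensate v ρ) (tAmp v ρ) q
              (Fock.conjAn (z _) (neg _) (halfSpace _) (condensate v ρ) (tAmp v ρ) p (xi v ρ)))
              (Fock.conjAn (z _) (neg _) (halfSpace _) (condensate v ρ) (tAmp v ρ) q'
                (Fock.conjAn (z _) (neg _) (halfSpace _) (condensate v ρ) (tAmp v ρ) p' (xi v ρ))) else 0).re /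
          (2 * boxSide ρ ^ 3)) =
      (∑ p, eps ρ p * (Fock.fockInner (Fock.conjAn (z _) (neg _) (halfSpace _) (condensate v ρ) (tAmp v ρ) p
          (Fock.cubicVector (e _) (hardSet ρ) (softSet ρ) (kappa v ρ)))
          (Fock.conjAn (z _) (neg _) (halfSpace _) (condensate v ρ) (tAmp v ρ) p
            (Fock.cubicVector (e _) (hardSet ρ) (softSet ρ) (kappa v ρ)))).re) +
        (∑ p, ∑ q, ∑ p', ∑ q', Fock.pairCoeff' (e _) Wc p q p' q' *
          Fock.fockInner (Fock.conjAn (z _) (neg _) (halfSpace _) (condensate v ρ) (tAmp v ρ) q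
            (Fock.conjAn (z _) (neg _) (halfSpace _) (condensate v ρ) (tAmp v ρ) p
              (Fock.cubicVector (e _) (hardSet ρ) (softSet ρ) (kappa v ρ))))
            (Fock.conjAn (z _) (neg _) (halfSpace _) (condensate v ρ) (tAmp v ρ) q'
              (Fock.conjAn (z _) (neg _) (halfSpace _) (condensate v ρ) (tAmp v ρ) p'
                (Fock.cubicVector (e _) (hardSet ρ) (softSet ρ) (kappa v ρ))))).re / (2 * boxSide ρ ^ 3) := by
    unfold xi eps
    congr 1
    congr 1
    refine congrArg Complex.re (Finset.sum_congr rfl fun p _ => Finset.sum_congr rfl fun q _ =>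
      Finset.sum_congr rfl fun p' _ => Finset.sum_congr rfl fun q' _ => ?_)
    unfold Fock.pairCoeff'
    split_ifs with h
    · show _ = ((W v ρ (e _ p' - e _ p) : ℝ) : ℂ) * _
      rw [ofReal_W]
    · rw [zero_mul]
  rw [hLHS, hNrm] at hE
  refine hE.trans (ENNReal.ofReal_le_ofReal ?_)
  rw [div_le_iff₀ (by linarith)]
  refine hT.trans (le_of_eq ?_)
  ring
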